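import Summits.ResolutionOfSingularities.ResolutionOfSingularities.Theses.PAlteration
import Summits.ResolutionOfSingularities.ResolutionOfSingularities.Theorems.RadicialJungCleanModelsSufficeReduction
import Summits.ResolutionOfSingularities.ResolutionOfSingularities.Theorems.PAlterationPicoverOfDegP

/-!
# Crux `Picover` (stmt-ResolutionOfSingularities-0554) — ALTERNATIVE line `jung-clean-base` (crux-strategist, 2026-08-17)

The crux (`PAlteration.Picover`): finite, universally injective, surjective covers `X → Y` of a regular
integral separated finite-type `Y/k` (`char k = p`), `X` integral, have resolutions. By the landed
degree-`p` tower (`Picover.OfDegP.picover_of_picoverDegP`, p91343) it is EQUIVALENT to its residue: for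
`W` regular and `L/K(W)` purely inseparable of degree `p`, `HasResolution (normalizationIn W L)`.

THIS LINE (transfer lens, Giraud's Jung condition for height-one radicial covers — the BASE-SIDE,
EMBEDDED alternative to the lead's line `degree-p-tower`, whose research stub is the non-embedded punctual
kernel at local dimension `≥ 4`): ALL blow-ups happen on the REGULAR base. The residue follows from

* `stub_cleanModelsR` (RESEARCH, the one open stub): ADAPTED LOG-CLEAN MODELS EXIST — for `W` regular
  integral separated of finite type over `k` and `L/K(W)` purely inseparable of degree `p` there is a proper
  birational REGULAR `π : V → W` carrying, at every point `v`, a generator `y` of `L/K(W)` whose `p`-th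
  power `g` pulls back to a monomial `∏ t_i^{a_i}` (`p ∤ a_i`, `0 < m`) in a regular system of parameters
  of `𝒪_{V,v}` (toroidal type) or to a unit `u₀` residually a non-`p`-th power or differing from a `p`-th
  power by a parameter transversal to the boundary (regular type), the first `r` parameters being cut out
  by sections `s` on a neighbourhood `U v` (a global snc-type boundary) with the joint-parameter and overlap
  clauses (exponents proportional mod `p`) that make the pointwise Kato charts compatible. This is VERBATIM
  the hypothesis `hCMR` of the landed `RadicialJung.CleanModelsSuffice.resolutionInChar_of_kato_of_adaptedModels`
  (Theorems/RadicialJungCleanModelsSufficeReductionR.lean), prefixed by `∀ p, p.Prime →`; it is the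
  recommended rider-restatement `CleanModelsR` of route RadicialJung's crux `CleanModels` (stmt-15917);
  Giraud 1983 (`dim W = 2`) and Cossart's 1987 thèse (`dim W = 3`, `y^p + f(u₁,u₂,u₃)`, cf. CossartPiltant2009
  p. 2) reach the Jung condition in completions; open from `dim W = 4`.
* `stub_kato1994Resolution`, `stub_kato1994Normal` (NAMED FACTS, not research; no stub-worker): Kato 1994
  (10.4) — a log-regular Zariski fs log scheme has a resolution — and (4.1) — a log-regular local ring is a
  normal domain (`Literature.AlgebraicGeometry.Resolution.Kato1994_logRegularScheme_hasResolution`,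
  `…Kato1994_logRegularLocal_isIntegrallyClosed`).

Composition (sorry-free, all glue LANDED by route RadicialJung's crux chain): an adapted clean model makes
`V^L` a log-regular Zariski fs log scheme (`stub_charts` + `atlasOfCharts`, Kummer-order algebra, all proved
in tree), Kato (10.4) resolves it, the resolution descends along the proper birational `V^L → W^L`
(`RadicialJung.CleanModelsSuffice.hasResolution_normalizationIn_of_adaptedModel`, p135821), and the
degree-`p` tower turns the residue into `Picover` BY NAME.

Why it dodges the STUCK goal of `degree-p-tower`: that line's open stub `stub_picoverKernel` asks for
`Sing`-supported blow-up desingularisations of arbitrary blow-ups of 4-dimensional p-cover GERMS (non-embedded,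
singular loci of dimension up to 3, no invariant in print: Cossart–Piltant's "test case" at `n ≥ 4`). Here the
singular scheme is never blown up: the open content is a log-principalization statement for the
`K(W)^p`-class of one function on a REGULAR variety, where order / Hilbert–Samuel / `E`-permissibility of the
coherent differential-content ideal are defined and upper-semicontinuous, the `p`-th-power ambiguity
`g ∼ g + c^p` (source of kangaroo / unbounded residual order, HauserPerlega2019) is invisible to `dg`, and a
counterexample would NOT refute resolution of singularities (the stub is strictly stronger than the residue)
— so the disprover can work on it, unlike on the kernel.

Disproof.lean (Cruxes/Picover, v4) honoured: §2a `IsRegular Y` is used (the base `W` must be regular for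
`dg`-cleaning to make sense); §2g excellence is consumed by finiteness of `normalizationInι` inside the landed
transport / charts; §4 no finite or homeomorphic resolution is claimed (Kato's resolution is a genuine log
blow-up); §6 the residue is honest. Negatives index: 0 refuted statements (2026-08-17).
-/

noncomputable section

set_option linter.dupNamespace false

open CategoryTheory AlgebraicGeometry TopologicalSpace
open Literature.AlgebraicGeometry.Resolution Literature.AlgebraicGeometry.Motives
open Summit.ResolutionOfSingularities.ResolutionOfSingularities.Theorems

namespace Summit.ResolutionOfSingularities.ResolutionOfSingularities.Cruxes.Picover.JungCleanBase

/-! ## Stubs -/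

/-- STUB (NAMED FACT, not research — verbatim the `Literature` named fact
`Literature.AlgebraicGeometry.Resolution.Kato1994_logRegularScheme_hasResolution`; discharged when its
`_holds` theorem lands; no stub-worker). **Kato 1994 (10.4)** (with (9.8), (9.11), (10.3); Nizioł 2006
Thm. 5.8): a quasi-compact scheme carrying a log-regular atlas of fs Zariski charts has a resolution.
[cite: Kato1994, (10.4)] [cite: Niziol2006, Thm. 5.8] -/
theorem stub_kato1994Resolution : Kato1994_logRegularScheme_hasResolution.{0} := by
  sorry

/-- STUB (NAMED FACT, not research — verbatim the `Literature` named fact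
`Literature.AlgebraicGeometry.Resolution.Kato1994_logRegularLocal_isIntegrallyClosed`; no stub-worker).
**Kato 1994 Thm. (4.1)**: a log-regular Noetherian local ring (one fs chart) is a normal domain.
[cite: Kato1994, Thm. (4.1)] -/
theorem stub_kato1994Normal : Kato1994_logRegularLocal_isIntegrallyClosed.{0} := by
  sorry

/-- STUB — THE RESEARCH CONTENT OF THE LINE (open from `dim W = 4`; Giraud 1983 `dim 2`, Cossart 1987
`dim 3` in completions). **Adapted log-clean regular models of the base exist** (`CleanModelsR`, all primes):
for `k` a field of characteristic `p`, `W` a regular integral separated `k`-scheme of finite type and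
`L/K(W)` purely inseparable of degree `p`, there is a proper birational regular integral `π : V → W` with,
at every `v ∈ V`, a generator `y v ∈ L ∖ K(W)`, `(y v)^p = g v`, a regular system of parameters `t v` of
`𝒪_{V,v}` whose first `r v` members are germs of sections `s v` on an open `U v ∋ v`, exponents `a v`
prime to `p`, such that `π^* (g v)` is the monomial `∏_{i < m v} (t v i)^{a v i}` with `0 < m v ≤ r v`
(toroidal type) or `m v = 0` and `π^*(g v)` is a unit `u₀` with `u₀ − x^p ∉ 𝔪_v` for all `x` or
`u₀ − x^p ∈ 𝔪_v ∖ (𝔪_v² + (t v 0, …, t v (r v − 1)))` for some `x` (regular type, transversal to the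
boundary); the sections `s v` stay part of a regular system of parameters at every `w ∈ U v` (joint
clause) and on overlaps `U v ∩ U v'` the boundary germs are associated with exponents proportional
modulo `p` (overlap clause). Verbatim `∀ p, p.Prime →` the hypothesis `hCMR` of
`RadicialJung.CleanModelsSuffice.resolutionInChar_of_kato_of_adaptedModels`.
[cite: Giraud1983Jung] [cite: CossartPiltant2009, Introduction p. 2 (Cossart [5], Moh [Mo])] -/
theorem stub_cleanModelsR : ∀ (p : ℕ), p.Prime → ∀ (k : Type) [Field k] [CharP k p] (W : Scheme.{0}) [IsIntegral W] (f : W ⟶ Spec (.of k)) (L : Type) [Field L] [Algebra W.functionField L], IsSeparated f → LocallyOfFiniteType f → QuasiCompact f → Scheme.IsRegular W → IsPurelyInseparable W.functionField L → Module.finrank W.functionField L = p → ∃ (V : Scheme.{0}) (π : V ⟶ W) (_ : IsIntegral V) (_ : IsDominant π), IsProper π ∧ IsBirational π ∧ Scheme.IsRegular V ∧ ∃ (y : V → L) (g : V → W.functionField) (d r m : V → ℕ) (hrd : ∀ v, r v ≤ d v) (hmr : ∀ v, m v ≤ r v) (t : ∀ v : V, Fin (d v) → V.presheaf.stalk v)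 (a : ∀ v : V, Fin (m v) → ℕ) (U : V → V.Opens) (hU : ∀ v, v ∈ U v) (s : ∀ v : V, Fin (r v) → Γ(V, U v)), (∀ v : V, y v ∉ Set.range (algebraMap W.functionField L) ∧ algebraMap W.functionField L (g v) = y v ^ p ∧ Ideal.span (Set.range (t v)) = IsLocalRing.maximalIdeal (V.presheaf.stalk v) ∧ ringKrullDim (V.presheaf.stalk v) = (d v : WithBot ℕ∞) ∧ (∀ i : Fin (r v), V.presheaf.germ (U v) v (hU v) (s v i) = t v (Fin.castLE (hrd v) i)) ∧ (∀ i : Fin (m v), ¬ p ∣ a v i) ∧ ((0 < m v ∧ RatFn.functionFieldMap π (g v) = ∏ i : Fin (m v), (algebraMap (V.presheaf.stalk v) V.functionField (t v (Fin.castLE ((hmr v).trans (hrd v)) i))) ^ (a v i)) ∨ (m v = 0 ∧ ∃ u₀ : V.presheaf.stalk v, IsUnit u₀ ∧ RatFn.functionFieldMap π (g v) = algebraMap (V.presheaf.stalk v) V.functionField u₀ ∧ ((∀ x : V.presheaf.stalk v, u₀ - x ^ p ∉ IsLocalRing.maximalIdeal (V.presheaf.stalk v)) ∨ (∃ x : V.presheaf.stalk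 v, u₀ - x ^ p ∈ IsLocalRing.maximalIdeal (V.presheaf.stalk v) ∧ u₀ - x ^ p ∉ IsLocalRing.maximalIdeal (V.presheaf.stalk v) ^ 2 ⊔ Ideal.span (Set.range fun i : Fin (r v) => t v (Fin.castLE (hrd v) i))))))) ∧ (∀ (v w : V) (hw : w ∈ U v), ∃ (dw : ℕ) (tw : Fin dw → V.presheaf.stalk w) (ι : Fin (r v) → Fin dw), Ideal.span (Set.range tw) = IsLocalRing.maximalIdeal (V.presheaf.stalk w) ∧ ringKrullDim (V.presheaf.stalk w) = (dw : WithBot ℕ∞) ∧ (∀ i : Fin (r v), V.presheaf.germ (U v) w hw (s v i) ∈ IsLocalRing.maximalIdeal (V.presheaf.stalk w) → tw (ι i) = V.presheaf.germ (U v) w hw (s v i)) ∧ (∀ i j : Fin (r v), V.presheaf.germ (U v) w hw (s v i) ∈ IsLocalRing.maximalIdeal (V.presheaf.stalk w) → V.presheaf.germ (U v) w hw (s v j) ∈ IsLocalRing.maximalIdeal (V.presheaf.stalk w) → ι i = ι j → i = j)) ∧ (∀ (v v' w : V) (hw : w ∈ U v) (hw' : w ∈ U v'), ∃ μ : ℕ,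 ¬ p ∣ μ ∧ ∀ i : Fin (r v), V.presheaf.germ (U v) w hw (s v i) ∈ IsLocalRing.maximalIdeal (V.presheaf.stalk w) → ∃ i' : Fin (r v'), Associated (V.presheaf.germ (U v) w hw (s v i)) (V.presheaf.germ (U v') w hw' (s v' i')) ∧ ((i : ℕ) < m v ↔ (i' : ℕ) < m v') ∧ (∀ (hi : (i : ℕ) < m v) (hi' : (i' : ℕ) < m v'), a v' ⟨i', hi'⟩ ≡ μ * a v ⟨i, hi⟩ [MOD p])) := by
  sorry

/-! ## Composition -/

/-- **The degree-`p` residue from the three stubs** (sorry-free modulo the stubs): for `W` regular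
integral separated of finite type over `k` (`char k = p`) and `L/K(W)` purely inseparable of degree `p`,
`normalizationIn W L` has a resolution — take the adapted clean model of `stub_cleanModelsR` and apply
`RadicialJung.CleanModelsSuffice.hasResolution_normalizationIn_of_adaptedModel` (charts + atlas + Kato
(10.4)/(4.1) + descent along `V^L → W^L`, landed p135821). [folklore] -/
theorem picoverDegP_of_stubs : ∀ (p : ℕ), p.Prime → ∀ (k : Type) [Field k] [CharP k p]
    (W : Scheme.{0}) [IsIntegral W] (f : W ⟶ Spec (.of k)) (L : Type) [Field L]
    [Algebra W.functionField L], IsSeparated f → LocallyOfFiniteType f → QuasiCompact f →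
    Scheme.IsRegular W → IsPurelyInseparable W.functionField L →
    Module.finrank W.functionField L = p → Scheme.HasResolution (normalizationIn W L) := by
  intro p hp k _ _ W _ f L _ _ hs hl hq hr hpi hd
  haveI := hs; haveI := hl; haveI := hq; haveI := hpi
  obtain ⟨V, π, hVi, hdom, hprop, hbir, hVreg, hRv⟩ :=
    stub_cleanModelsR p hp k W f L hs hl hq hr hpi hd
  haveI := hVi; haveI := hdom; haveI := hprop
  exact RadicialJung.CleanModelsSuffice.hasResolution_normalizationIn_of_adaptedModel
    stub_kato1994Resolution stub_kato1994Normal p hp k W f L hd V π hbir hVreg hRv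

/-- **The line closes the crux modulo its stubs**: `Picover` BY NAME — the residue
(`picoverDegP_of_stubs`) fed to Temkin's degree-`p` tower `Picover.OfDegP.picover_of_picoverDegP`
(landed p91343). [folklore] -/
theorem Picover_of : Summit.ResolutionOfSingularities.ResolutionOfSingularities.Theses.PAlteration.Picover :=
  Picover.OfDegP.picover_of_picoverDegP picoverDegP_of_stubs

end Summit.ResolutionOfSingularities.ResolutionOfSingularities.Cruxes.Picover.JungCleanBase

end
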